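import Mathlib
import Summits.CriticalPhenomena.PercolationContinuityZ3.Theses.PercBudgetLadder
import Summits.CriticalPhenomena.PercolationContinuityZ3.Theorems.PinholeClosing.Negative.PinholeClosingResistance
import Summits.CriticalPhenomena.PercolationContinuityZ3.Theorems.PercBudgetLadderSufficesTarget
import Summits.CriticalPhenomena.PercolationContinuityZ3.Theorems.PercBudgetLadderBlockingVanishesOfTheta
import Summits.CriticalPhenomena.PercolationContinuityZ3.Theorems.PercBudgetLadderPinholeClosingShellExclusion
import Summits.CriticalPhenomena.PercolationContinuityZ3.Theorems.PercBudgetLadderPinholeClosingShellChart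
import Summits.CriticalPhenomena.PercolationContinuityZ3.Theorems.PercBudgetLadderPinholeClosingShellMerge
import Summits.CriticalPhenomena.PercolationContinuityZ3.Theorems.PercBudgetLadderPinholeClosingShellSqueeze
import Literature.Probability.Percolation.MinOpenCut
import Literature.Probability.Percolation.SiteConnectionTools
import HarnessLib

/-!
# Crux `PercBudgetLadder.PinholeClosing` (stmt-CriticalPhenomena-5249) — line `budget-halving`, SHELL form (lead c3)

Skeleton of lead `prover-line-stmt-CriticalPhenomena-5249-c3-0` for the line `budget-halving`
(`Cruxes/PinholeClosing/Lines/budget_halving.lean`, idea card `Ideas/budget-halving.md`), RESHAPED: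
the window pockets are merged over a cube SURFACE (the grid translates `u • z`, `‖z‖∞ = 4l`, of the
premise window), not over a ball.  Submodularity of the open cut function + floors in cut form give ONE
finite set `V ⊇ {‖x‖∞ = 4lu}` with at most `j = k + 1` open boundary edges in total, disjoint from the
centre floor box `box u` and inside `box (12lu - 1)`; its open doors split into inner-side and outer-side
ones, each class alone is a cutset of the centred annulus `box u → ∂ⁱⁿ box (12lu)`, and one class has
`≤ ⌊j/2⌋ ≤ j - 1 = k` edges.  So "caps at every surface translate ⇒ the conclusion event at some grid
translate" holds for EVERY budget level, deterministically, on lattice configurations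
(`exclusion`); Harris–FKG over the `≤ (8l+1)³` caps, the union bound over the `(8l+1)³` grid
translates and shift invariance (`stub_shellSqueeze`) turn it into
`P(budget k at (u, 12lu)) ≥ c^{(8l+1)³} / (8l+1)³`, `u = ⌊n/2⌋`, uniformly in `n ≥ 2`
(`n = 1` by finite energy).

What this closes: the RESTATED crux `PinholeClosingRestated` (body = `Cruxes/PinholeClosing/
RestatedGlue_cruxplan_budget_halving.lean`, whose deciding theorem `closes_restated` the crux-plan seat
certified; here with `j = 2`, `l' = 12 l`), and hence — composing with the route's PROVED
`SufficesTarget` / `BlockingVanishesOfTheta` — `BudgetTightness → CritAnnulusBlockedIO` and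
`BudgetTightness → PercolationContinuityZ3` as theorems.  It does NOT close the decl AS TYPED (equal
inner radii `n`, outer radius `2ln`): at equal inner radii no deterministic exclusion exists
(`CorridorWorlds-ideator2.md`, `TilingNoGoK1-cert.md`), and the typed decl is strictly stronger than
what the route's `closes` consumes.

Stubs (registered): `stub_blockedOfShell` (the two-sided cut), `stub_shellMerge` (door lemma + floors-in-cut-form +
six-face chart merge; lead; its bookkeeping half is the auxiliary `stub_chartMerge`), `stub_shellSqueeze` (Harris + union
bound + shift invariance; worker).  ALL LANDED — this skeleton is sorry-free: `Theorems/PercBudgetLadderPinholeClosing`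
`ShellExclusion.lean` (p141041), `…ShellSqueeze.lean` (p141147), `…ShellChart.lean`, `…ShellMerge.lean`; the composition
is landed as `…ShellHalving.lean` (`Theorems.pinholeClosingRestated_proof`, registered `stub_pinholeClosingRestated`,
`Theorems.critAnnulusBlockedIO_of_budgetTightness`, `Theorems.percolationContinuityZ3_of_budgetTightness`).
-/

noncomputable section

namespace Summit.CriticalPhenomena.PercolationContinuityZ3.Cruxes.PinholeClosing.ShellHalving

open MeasureTheory
open scoped Classical
open Literature.Probability.Percolation Literature.Probability.LatticeModels
open Summit.CriticalPhenomena.PercolationContinuityZ3.Theses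
open Summit.CriticalPhenomena.PercolationContinuityZ3.Theorems
open Summit.CriticalPhenomena.PercolationContinuityZ3.Theorems.PinholeClosing

/-! ## §0 Dictionary (local abbreviations; the stubs are stated in raw tree vocabulary) -/

/-- Budget-`j` blocked event of the TRANSLATED window `y + (box 3 n → ∂ⁱⁿ box 3 L)` inside `y + box 3 L`. -/
def bAt (y : Site 3) (j n L : ℕ) : Set (BondConfig (Site 3)) :=
  {ω : BondConfig (Site 3) | ∃ S : Finset (Sym2 (Site 3)), S.card ≤ j ∧ ¬ ∃ x ∈ (box 3 n).image (· + y),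
    ∃ z ∈ (innerBoundary (zdGraph 3) (box 3 L)).image (· + y),
      (ω \ (↑S : Set (Sym2 (Site 3)))) ∈ openConnIn (↑((box 3 L).image (· + y)) : Set (Site 3)) x z}

/-- Budget-`j` blocked event of the centred window (VERBATIM the route's set-builder). -/
def bEv (j n L : ℕ) : Set (BondConfig (Site 3)) :=
  {ω : BondConfig (Site 3) | ∃ S : Finset (Sym2 (Site 3)), S.card ≤ j ∧ ¬ ∃ x ∈ box 3 n,
    ∃ y ∈ innerBoundary (zdGraph 3) (box 3 L),
      (ω \ (↑S : Set (Sym2 (Site 3)))) ∈ openConnIn (↑(box 3 L) : Set (Site 3)) x y}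

/-- Translating by `0` does nothing. -/
theorem image_add_zero (s : Finset (Site 3)) : s.image (· + (0 : Site 3)) = s := by
  simp

/-- The translated event at `y = 0` is the centred event. -/
theorem bAt_zero (j n L : ℕ) : bAt 0 j n L = bEv j n L := by
  simp only [bAt, bEv, image_add_zero]

/-- `0 ∈ box 3 R`. -/
theorem zero_mem_box (R : ℕ) : (0 : Site 3) ∈ box 3 R := by
  rw [mem_box]
  intro i
  simp

/-! ## §1 The restated crux (body proposed by the crux-plan seat; `closes_restated` certified) -/

/-- **`PinholeClosingRestated`** — hypothesis as in the crux (budget `k+1` at inner radius `n`, aspect `l`,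
probability `≥ c`, every `n ≥ 1`); conclusion: budget `k` at SOME inner radius `m` with `n ≤ 2^j m` and outer
radius `l' m`, probability `≥ c'`, where `j, l', c'` depend on `(k, l, c)` only.  VERBATIM the body of
`PercBudgetLadder.PinholeClosingRestated` in `Cruxes/PinholeClosing/RestatedGlue_cruxplan_budget_halving.lean`. -/
def PinholeClosingRestated : Prop :=
  ∀ (k l : ℕ) (c : ℝ), 2 ≤ l → 0 < c → ∃ (j l' : ℕ) (c' : ℝ), 2 ≤ l' ∧ 0 < c' ∧ ∀ n : ℕ, 1 ≤ n → c ≤ (Literature.Probability.Percolation.bondPercolation (Literature.Probability.LatticeModels.zdGraph 3) (Literature.Probability.Percolation.criticalProbI 3)).real {ω | ∃ S : Finset (Sym2 (Literature.Probability.LatticeModels.Site 3)), S.card ≤ k + 1 ∧ ¬ ∃ x ∈ Literature.Probability.LatticeModels.box 3 n, ∃ y ∈ Literature.Probability.LatticeModels.innerBoundary (Literature.Probability.LatticeModels.zdGraph 3) (Literature.Probability.LatticeModels.box 3 (l * n)), (ω \ ↑S) ∈ Literature.Probability.Percolation.openConnIn ↑(Literature.Probability.LatticeModels.box 3 (l *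 n)) x y} → ∃ m : ℕ, n ≤ 2 ^ j * m ∧ c' ≤ (Literature.Probability.Percolation.bondPercolation (Literature.Probability.LatticeModels.zdGraph 3) (Literature.Probability.Percolation.criticalProbI 3)).real {ω | ∃ S : Finset (Sym2 (Literature.Probability.LatticeModels.Site 3)), S.card ≤ k ∧ ¬ ∃ x ∈ Literature.Probability.LatticeModels.box 3 m, ∃ y ∈ Literature.Probability.LatticeModels.innerBoundary (Literature.Probability.LatticeModels.zdGraph 3) (Literature.Probability.LatticeModels.box 3 (l' * m)), (ω \ ↑S) ∈ Literature.Probability.Percolation.openConnIn ↑(Literature.Probability.LatticeModels.box 3 (l' * m)) x y}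

/-! ## §2 The stubs (registered shape `theorem stub_… : … := by sorry`) -/

/-- **stub_blockedOfShell** (the two-sided cut; deterministic, lattice configurations).  A finite set `V` with
at most `j ≥ 1` open lattice boundary edges, disjoint from `box m`, inside `box (M - 1)`, containing the sup-norm
sphere `box R ∖ box (R - 1)` (`m + 1 ≤ R`, `R + 1 ≤ M`): then `box m → ∂ⁱⁿ box M` is blocked inside `box M` after
closing at most `j - 1` edges (the inner-side doors and the outer-side doors of `V` are each a cutset, and one
class has at most `⌊j/2⌋` edges).  PROVED: `work/ShellExclusion.lean`, `blocked_of_shell`. -/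
theorem stub_blockedOfShell :
    ∀ (j m R M : ℕ) (ω : BondConfig (Site 3)) (V : Finset (Site 3)), ω ⊆ (zdGraph 3).edgeSet →
      1 ≤ j → m + 1 ≤ R → R + 1 ≤ M → ((edgeBoundary (zdGraph 3) V).filter (· ∈ ω)).card ≤ j →
      Disjoint V (box 3 m) → V ⊆ box 3 (M - 1) → (∀ x ∈ box 3 R, x ∉ box 3 (R - 1) → x ∈ V) →
      ∃ S : Finset (Sym2 (Site 3)), S.card ≤ j - 1 ∧ ¬ ∃ x ∈ box 3 m,
        ∃ y ∈ innerBoundary (zdGraph 3) (box 3 M),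
          (ω \ (↑S : Set (Sym2 (Site 3)))) ∈ openConnIn (↑(box 3 M) : Set (Site 3)) x y :=
  Theorems.stub_blockedOfShell  -- LANDED p141041 (Theorems/PercBudgetLadderPinholeClosingShellExclusion.lean)

/-- **stub_shellMerge** (deterministic, lattice configurations; the lead's stub).  Scale `u ≥ 1`, source radius
`n ∈ [2u, 3u]`, aspect `l ≥ 2`, budget `j ≥ 1`.  CAPS: every grid translate `u • z`, `‖z‖∞ = 4l`, of the window
`box n → ∂ⁱⁿ box (3lu)` is budget-`j` blocked.  FLOORS: no such translate of the window `box u → ∂ⁱⁿ box (12lu)`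
is budget-`(j-1)` blocked.  THEN there is a finite `V` with at most `j` open boundary edges, disjoint from
`box u`, inside `box (12lu - 1)`, containing the sphere `box (4lu) ∖ box (4lu - 1)`.  Proof: door lemma (each cap
gives a pocket `U_z ⊇ u•z + box n` with `≤ j` open doors inside its window), floors in cut form (every `X`
between a floor box and its far sphere has `≥ j` open doors), submodularity merge along the rows of the six
faces (`work/ShellExclusion.lean`: `door_lemma`, `floor_cut`, `row_merge`, `face_merge`), cover of the sphere by
the source boxes `u•z + box n` (`u ≤ n`). -/
theorem stub_shellMerge :
    ∀ (j n l u : ℕ) (ω : BondConfig (Site 3)), ω ⊆ (zdGraph 3).edgeSet → 1 ≤ j → 2 ≤ l → 1 ≤ u →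
      2 * u ≤ n → n ≤ 3 * u →
      (∀ z ∈ box 3 (4 * l), z ∉ box 3 (4 * l - 1) →
        ∃ S : Finset (Sym2 (Site 3)), S.card ≤ j ∧ ¬ ∃ x ∈ (box 3 n).image (· + (u : ℤ) • z),
          ∃ y ∈ (innerBoundary (zdGraph 3) (box 3 (3 * l * u))).image (· + (u : ℤ) • z),
            (ω \ (↑S : Set (Sym2 (Site 3)))) ∈
              openConnIn (↑((box 3 (3 * l * u)).image (· + (u : ℤ) • z)) : Set (Site 3)) x y) →
      (∀ z ∈ box 3 (4 * l), z ∉ box 3 (4 * l - 1) →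
        ¬ ∃ S : Finset (Sym2 (Site 3)), S.card ≤ j - 1 ∧ ¬ ∃ x ∈ (box 3 u).image (· + (u : ℤ) • z),
          ∃ y ∈ (innerBoundary (zdGraph 3) (box 3 (12 * l * u))).image (· + (u : ℤ) • z),
            (ω \ (↑S : Set (Sym2 (Site 3)))) ∈
              openConnIn (↑((box 3 (12 * l * u)).image (· + (u : ℤ) • z)) : Set (Site 3)) x y) →
      ∃ V : Finset (Site 3), ((edgeBoundary (zdGraph 3) V).filter (· ∈ ω)).card ≤ j ∧
        Disjoint V (box 3 u) ∧ V ⊆ box 3 (12 * l * u - 1) ∧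
        ∀ x ∈ box 3 (4 * l * u), x ∉ box 3 (4 * l * u - 1) → x ∈ V :=
  Theorems.stub_shellMerge  -- LANDED (Theorems/PercBudgetLadderPinholeClosingShellMerge.lean)

/-- **stub_chartMerge** (auxiliary, registered by `stub-add`; the bookkeeping half of `stub_shellMerge`): pockets `U z`
with `≤ j` open doors containing the source boxes `box n + u • p(s,t)` of a chart `p : ℕ → ℕ → ℤ³` whose consecutive
points are sup-norm neighbours, floors (`≥ j` open doors between the floor box `box u + u • p(s,t)` and the pocket),
`2u ≤ n`, and a previous set with `≤ j` open doors containing the source box of `p(0,0)`: the merged union has `≤ j`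
open doors (submodularity, `row_merge`/`face_merge`). -/
theorem stub_chartMerge :
    ∀ (j K n u : ℕ) (ω : BondConfig (Site 3)) (U : Site 3 → Finset (Site 3)) (p : ℕ → ℕ → Site 3)
      (Prev : Finset (Site 3)),
      (∀ s < K, ∀ t < K, ((edgeBoundary (zdGraph 3) (U (p s t))).filter (· ∈ ω)).card ≤ j) →
      (∀ s < K, ∀ t < K, (box 3 n).image (· + (u : ℤ) • p s t) ⊆ U (p s t)) →
      (∀ s < K, ∀ t < K, ∀ X : Finset (Site 3), (box 3 u).image (· + (u : ℤ) • p s t) ⊆ X → X ⊆ U (p s t) →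
        j ≤ ((edgeBoundary (zdGraph 3) X).filter (· ∈ ω)).card) →
      (∀ s t, ∀ i, |p s (t + 1) i - p s t i| ≤ 1) → (∀ s, ∀ i, |p (s + 1) 0 i - p s 0 i| ≤ 1) → 2 * u ≤ n →
      ((edgeBoundary (zdGraph 3) Prev).filter (· ∈ ω)).card ≤ j →
      (box 3 n).image (· + (u : ℤ) • p 0 0) ⊆ Prev →
      ((edgeBoundary (zdGraph 3)
        (Prev ∪ (Finset.range K).biUnion fun s => (Finset.range K).biUnion fun t => U (p s t))).filter
          (· ∈ ω)).card ≤ j :=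
  Theorems.stub_chartMerge  -- LANDED (Theorems/PercBudgetLadderPinholeClosingShellChart.lean)

/-- **stub_shellSqueeze** (probabilistic; worker's stub).  IF the centred window `box n → ∂ⁱⁿ box (3lu)` is
budget-`j` blocked with probability `≥ c ≥ 0`, AND the deterministic exclusion "lattice configuration + caps at
every surface translate `u • z` (`‖z‖∞ = 4l`) ⇒ the window `box u → ∂ⁱⁿ box (12lu)` is budget-`(j-1)` blocked at
some grid translate `u • z`, `‖z‖∞ ≤ 4l`" holds, THEN `c ^ ((8l+1)³) ≤ (8l+1)³ · P(budget j-1 at (u, 12lu))`.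
Proof route: the caps are decreasing (`isUpperSet_openConnIn`) and measurable (finite windows,
`measurableSet_setOf_minOpenCutIn_le` + `minOpenCutIn_le_iff`), each of probability `= P(centred cap) ≥ c` by shift
invariance (`bondPercolation_real_preimage_shift` + `HalfspaceHalving.preimage_relabel_budgetBlocked`), so Harris
(`StubHarrisTiles.pow_card_le_real_biInter`) gives `P(⋂ caps) ≥ c^#caps ≥ c^((8l+1)³)` (`c ≤ 1`, `#caps ≤ #box 3 (4l)`);
the exclusion holds a.s. (`real_mono_of_lattice`) and the union bound (`measureReal_biUnion_finset_le`) + shift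
invariance bound `P(⋂ caps)` by `#box 3 (4l) · P(centred conclusion) = (8l+1)³ · P(…)` (`card_box`). -/
theorem stub_shellSqueeze :
    ∀ (j n l u : ℕ) (c : ℝ), 0 ≤ c →
      c ≤ (bondPercolation (zdGraph 3) (criticalProbI 3)).real
        {ω : BondConfig (Site 3) | ∃ S : Finset (Sym2 (Site 3)), S.card ≤ j ∧ ¬ ∃ x ∈ box 3 n,
          ∃ y ∈ innerBoundary (zdGraph 3) (box 3 (3 * l * u)),
            (ω \ (↑S : Set (Sym2 (Site 3)))) ∈ openConnIn (↑(box 3 (3 * l * u)) : Set (Site 3)) x y} →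
      (∀ ω : BondConfig (Site 3), ω ⊆ (zdGraph 3).edgeSet →
        (∀ z ∈ box 3 (4 * l), z ∉ box 3 (4 * l - 1) →
          ∃ S : Finset (Sym2 (Site 3)), S.card ≤ j ∧ ¬ ∃ x ∈ (box 3 n).image (· + (u : ℤ) • z),
            ∃ y ∈ (innerBoundary (zdGraph 3) (box 3 (3 * l * u))).image (· + (u : ℤ) • z),
              (ω \ (↑S : Set (Sym2 (Site 3)))) ∈
                openConnIn (↑((box 3 (3 * l * u)).image (· + (u : ℤ) • z)) : Set (Site 3)) x y) →
        ∃ z ∈ box 3 (4 * l), ∃ S : Finset (Sym2 (Site 3)), S.card ≤ j - 1 ∧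
          ¬ ∃ x ∈ (box 3 u).image (· + (u : ℤ) • z),
            ∃ y ∈ (innerBoundary (zdGraph 3) (box 3 (12 * l * u))).image (· + (u : ℤ) • z),
              (ω \ (↑S : Set (Sym2 (Site 3)))) ∈
                openConnIn (↑((box 3 (12 * l * u)).image (· + (u : ℤ) • z)) : Set (Site 3)) x y) →
      c ^ ((8 * l + 1) ^ 3) ≤ (((8 * l + 1) ^ 3 : ℕ) : ℝ) *
        (bondPercolation (zdGraph 3) (criticalProbI 3)).real
          {ω : BondConfig (Site 3) | ∃ S : Finset (Sym2 (Site 3)), S.card ≤ j - 1 ∧ ¬ ∃ x ∈ box 3 u,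
            ∃ y ∈ innerBoundary (zdGraph 3) (box 3 (12 * l * u)),
              (ω \ (↑S : Set (Sym2 (Site 3)))) ∈ openConnIn (↑(box 3 (12 * l * u)) : Set (Site 3)) x y} :=
  Theorems.stub_shellSqueeze  -- LANDED p141147 (Theorems/PercBudgetLadderPinholeClosingShellSqueeze.lean)

/-! ## §3 The composition (real proofs) -/

/-- **Exclusion (deterministic).**  On a lattice configuration, caps at every surface translate force the
conclusion window `box u → ∂ⁱⁿ box (12lu)` to be budget-`(j-1)` blocked at some grid translate `u • z`,
`‖z‖∞ ≤ 4l` (in fact at `z = 0`): otherwise the floors hold at every surface translate and at the centre,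
`stub_shellMerge` produces the shell bag `V`, and `stub_blockedOfShell` blocks the centred window — contradicting
the centre floor. -/
theorem exclusion (j n l u : ℕ) (hj : 1 ≤ j) (hl : 2 ≤ l) (hu : 1 ≤ u) (h2u : 2 * u ≤ n) (h3u : n ≤ 3 * u)
    (ω : BondConfig (Site 3)) (hω : ω ⊆ (zdGraph 3).edgeSet)
    (hcaps : ∀ z ∈ box 3 (4 * l), z ∉ box 3 (4 * l - 1) → ω ∈ bAt ((u : ℤ) • z) j n (3 * l * u)) :
    ∃ z ∈ box 3 (4 * l), ω ∈ bAt ((u : ℤ) • z) (j - 1) u (12 * l * u) := by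
  by_contra hne
  push Not at hne
  obtain ⟨V, hV, hVu, hVM, hcov⟩ :=
    stub_shellMerge j n l u ω hω hj hl hu h2u h3u hcaps (fun z hz _ => hne z hz)
  have hlu : 1 ≤ l * u := Nat.mul_le_mul (by omega : 1 ≤ l) hu
  have h8 : 8 * u ≤ 4 * l * u := Nat.mul_le_mul_right u (by omega)
  have hR : u + 1 ≤ 4 * l * u := by omega
  have hRM : 4 * l * u + 1 ≤ 12 * l * u := by
    rw [Nat.mul_assoc, Nat.mul_assoc]
    omega
  have key := stub_blockedOfShell j u (4 * l * u) (12 * l * u) ω V hω hj hR hRM hV hVu hVM hcov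
  apply hne 0 (zero_mem_box _)
  rw [smul_zero, bAt_zero]
  exact key

/-- **The restated crux, proved modulo the stubs** (`j = 2`, `l' = 12 l`,
`c' = min (c^N / N) (P(budget k at (1, 12 l)))`, `N = (8l+1)³`).  For `n ≥ 2`: `u = ⌊n/2⌋`, the premise at aspect
`l` gives the centred cap at outer radius `3lu ≥ ln` (`blockProb_mono_aspect`), `stub_shellSqueeze` + `exclusion`
give the conclusion at `(u, 12lu)` with probability `≥ c^N / N`, and `n ≤ 4u`; for `n = 1` finite energy. -/
theorem pinholeClosingRestated_of : PinholeClosingRestated := by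
  intro k l c hl hc
  have hNpos : (0 : ℝ) < (((8 * l + 1) ^ 3 : ℕ) : ℝ) := by positivity
  have h12 : 1 < 12 * l * 1 := by omega
  have hc₀ := Negative.blockProb_pos (k := k) h12
  refine ⟨2, 12 * l, min (c ^ ((8 * l + 1) ^ 3) / (((8 * l + 1) ^ 3 : ℕ) : ℝ))
      ((bondPercolation (zdGraph 3) (criticalProbI 3)).real
        {ω : BondConfig (Site 3) | ∃ S : Finset (Sym2 (Site 3)), S.card ≤ k ∧ ¬ ∃ x ∈ box 3 (1),
          ∃ y ∈ innerBoundary (zdGraph 3) (box 3 (12 * l * 1)),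
            (ω \ (↑S : Set (Sym2 (Site 3)))) ∈ openConnIn (↑(box 3 (12 * l * 1)) : Set (Site 3)) x y}),
    by omega, lt_min (div_pos (pow_pos hc _) hNpos) hc₀, ?_⟩
  intro n hn hprem
  rcases Nat.lt_or_ge n 2 with hn2 | hn2
  · -- n = 1: finite energy at m = 1
    obtain rfl : n = 1 := by omega
    exact ⟨1, by norm_num, min_le_right _ _⟩
  · -- n ≥ 2: u = ⌊n/2⌋, caps at aspect 3lu, squeeze + exclusion, n ≤ 4u
    set u : ℕ := n / 2 with hu_def
    have hu : 1 ≤ u := by omega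
    have h2u : 2 * u ≤ n := by omega
    have h3u : n ≤ 3 * u := by omega
    have h4u : n ≤ 2 ^ 2 * u := by
      have : 2 ^ 2 * u = 4 * u := by norm_num
      omega
    have hln : n ≤ l * n := Nat.le_mul_of_pos_left n (by omega)
    have hl3 : l * n ≤ 3 * l * u :=
      calc l * n ≤ l * (3 * u) := Nat.mul_le_mul_left l h3u
        _ = 3 * l * u := by ring
    have hcap : c ≤ (bondPercolation (zdGraph 3) (criticalProbI 3)).real (bEv (k + 1) n (3 * l * u)) :=
      hprem.trans (Negative.blockProb_mono_aspect hln hl3)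
    have hsq := stub_shellSqueeze (k + 1) n l u c hc.le hcap (fun ω hω hcaps =>
      exclusion (k + 1) n l u (by omega) hl hu h2u h3u ω hω hcaps)
    simp only [Nat.add_sub_cancel] at hsq
    refine ⟨u, h4u, (min_le_left _ _).trans ?_⟩
    rw [div_le_iff₀ hNpos]
    exact hsq.trans_eq (mul_comm _ _)

/-- **The ladder reaches the target under the restatement**: `BudgetTightness → CritAnnulusBlockedIO`
UNCONDITIONALLY in the restated crux (pure logic, the `descent` of `closes_restated`: a `K`-step descent in
which the inner radius of the i.o. subsequence shrinks by `2^j` per step, hence still tends to infinity). -/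
theorem critAnnulusBlockedIO_of_budgetTightness (hBT : PercBudgetLadder.BudgetTightness) :
    PercBudgetLadder.CritAnnulusBlockedIO := by
  have hPC := pinholeClosingRestated_of
  -- dictionary, local to the proof
  let P : ℕ → ℕ → ℕ → ℝ := fun k n m =>
    (bondPercolation (zdGraph 3) (criticalProbI 3)).real
      {ω | ∃ S : Finset (Sym2 (Site 3)), S.card ≤ k ∧ ¬ ∃ x ∈ box 3 n,
        ∃ y ∈ innerBoundary (zdGraph 3) (box 3 m), (ω \ ↑S) ∈ openConnIn ↑(box 3 m) x y}
  have descent : ∀ K : ℕ, ∀ (l : ℕ) (c : ℝ), 2 ≤ l → 0 < c →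
      (∀ N : ℕ, ∃ n : ℕ, N ≤ n ∧ c ≤ P K n (l * n)) →
      ∃ (l' : ℕ) (c' : ℝ), 2 ≤ l' ∧ 0 < c' ∧ ∀ N : ℕ, ∃ n : ℕ, N ≤ n ∧ c' ≤ P 0 n (l' * n) := by
    intro K
    induction K with
    | zero => exact fun l c hl hc h => ⟨l, c, hl, hc, h⟩
    | succ K ih =>
      intro l c hl hc h
      obtain ⟨j, l', c', hl', hc', hstep⟩ := hPC K l c hl hc
      refine ih l' c' hl' hc' fun N => ?_
      obtain ⟨n, hn, hb⟩ := h (2 ^ j * N + 1)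
      obtain ⟨m, hm, hbm⟩ := hstep n (by omega) hb
      refine ⟨m, ?_, hbm⟩
      have h3 : 2 ^ j * N ≤ 2 ^ j * m := (Nat.le_of_succ_le hn).trans hm
      exact Nat.le_of_mul_le_mul_left h3 (Nat.two_pow_pos j)
  obtain ⟨K, l, c, hl, hc, hio⟩ := hBT
  obtain ⟨l', c', hl', hc', hio'⟩ := descent K l c hl hc hio
  refine ⟨l', c', hl', hc', fun N => ?_⟩
  obtain ⟨n, hn, hbound⟩ := hio' N
  refine ⟨n, hn, ?_⟩
  have hset :
      {ω : Set (Sym2 (Site 3)) | ∃ S : Finset (Sym2 (Site 3)), S.card ≤ 0 ∧ ¬ ∃ x ∈ box 3 n,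
          ∃ y ∈ innerBoundary (zdGraph 3) (box 3 (l' * n)), (ω \ ↑S) ∈ openConnIn ↑(box 3 (l' * n)) x y} =
      {ω | ¬ ∃ x ∈ box 3 n, ∃ y ∈ innerBoundary (zdGraph 3) (box 3 (l' * n)),
          ω ∈ openConnIn ↑(box 3 (l' * n)) x y} := by
    ext ω
    constructor
    · rintro ⟨S, hS, hnot⟩
      have hS0 : S = ∅ := Finset.card_eq_zero.mp (Nat.le_zero.mp hS)
      subst hS0
      simpa using hnot
    · intro hnot
      exact ⟨∅, by simp, by simpa using hnot⟩
  have hb' : c' ≤ P 0 n (l' * n) := hbound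
  simp only [P] at hb'
  rw [hset] at hb'
  exact hb'

/-- **`θ(p_c) = 0` on `ℤ³` from bounded-budget tightness ALONE**: `BudgetTightness → PercolationContinuityZ3`,
by `critAnnulusBlockedIO_of_budgetTightness` and the route's proved `SufficesTarget` + `BlockingVanishesOfTheta`.
Through this line the crux `PinholeClosing` (r3) stops being load-bearing: the single open input of the
ladder is `BudgetTightness` (r2). -/
theorem percolationContinuityZ3_of_budgetTightness (hBT : PercBudgetLadder.BudgetTightness) :
    _root_.PercolationContinuityZ3 :=
  sufficesTarget_proof (critAnnulusBlockedIO_of_budgetTightness hBT) BlockingVanishesOfTheta_proof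

end Summit.CriticalPhenomena.PercolationContinuityZ3.Cruxes.PinholeClosing.ShellHalving

end
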